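import Summits.QuantumFields.BalabanUV.Beta.D1BFx.RProjectorJetColumns
import Summits.QuantumFields.BalabanUV.Beta.D1BFx.RJetProjector

/-!
# `BalabanUV.Beta.D1BFx.LandauMultiplierMean` — road «BF-x» for binder row D1, slot (K), dictionary brick (M):
# `Q′·G′·R = 0` on `ℤ⁴` — THE BLOCK SUMS OF AN R-WEIGHTED GAUGE-MULTIPLIER COLUMN VANISH

K-R1-SPEC v2 §2 (owner memo g4 §3 step (1)): in the kernel-level dictionary `wH = Ga𝒬ᵀCun` / `Gam = Γ_R − d∘𝔅∘δ` (to be proved by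
`KKTFluctuationUnique.eq_wH_of_solvesKKT` / `eq_Gam_of_solvesKKT` once the vector-leg equation X₁ is in the tree), the candidate gauge
multiplier of the typed sharp weak-Landau system is `μ := −G′R(δℋ_R)` (`G′ = Ggh n a` the massive scalar tower, `R = 1 − P`, `P = Pgt n a` the
projector of B9 (3.25) at `U = 1`), and hypothesis (M) of `SolvesKKT` asks that EVERY BLOCK SUM OF `μ` VANISH.  THIS FILE proves the lattice
identity behind it, with NO input beyond J5.0/J5-kernel (leaf-09 `RProjector`, leaf-07-g2 `RProjectorRange`/`RProjectorJetColumns`):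
* §1 `sum_blk_Ggh` (`Σ_{p ∈ B(y)} G′(q,p) = (G′Q′*)(q,y)`, definitional), `sum_blk_comp_Pgt_Ggh` (`Σ_{p ∈ B(y)} (P∘G′)(q,p) = (G′Q′*)(q,y)`, i.e.
  `P·(G′Q′*) = G′Q′*` read through the symmetry of `P` — `RProjectorRange.tsum_gq_mul_Pgt` BY NAME), hence
  **`sum_blk_RG_eq_zero`: `Σ_{p ∈ B(y)} (R∘G′)(q,p) = 0`** for every fine `q` and every block `y` — `Q′·(G′R)ᵀ = Q′·(RG′)… = 0`, i.e. the range of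
  `R` is `ℓ²`-orthogonal to the block-constant functions after `G′`: `Q′G′R = 0`;
* §2 **`sum_blk_tsum_RG_mul_eq_zero`**: for every BOUNDED fine function `g`, the 0-form `μ(p) := Σ'_q (R∘G′)(q,p)·g(q)` (= `(G′R g)(p)` by the
  symmetries of `G′`, `P`) has ALL BLOCK SUMS ZERO — hypothesis (M) for the dictionary's multiplier, unconditionally.

HONEST FRAMING (cell contract, verbatim): «discharging `BetaPertH` makes Bałaban's UV stability UNCONDITIONAL — a real constructive-QFT
result; it is NOT the continuum limit and NOT the Clay problem.»  HONEST DEPENDENCY (verbatim): «continuum YM on T⁴ ⇐ BetaPertH ∧ nine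
spine estimates (0/9 proved); BetaPertH ⇐ (D1) ∧ (D4) ∧ CAP+tail; G-an2-4 gates asym, D1 and NE2/3/4.»  [folklore] absolutely convergent
lattice bookkeeping; no `Prop` is minted, nothing is cited, no wall binder is instantiated; 0 sorry.  NOT summit progress.
ABSOLUTE RULE (cell, verbatim): «No internally-minted statement may enter as a cited fact. Every hypothesis is either kernel-proved in this
package or a verbatim quotation of a PUBLISHED theorem with page reference. The manuscript(s) under audit are NOT citable for their own
disputed steps — they are the thing under adjudication; programme-internal (2001/route/tribunal) claims are never citable.»
Provenance: road «BF-x» owner gen 4 (prover-b2b-balaban-beta-d1-p2-g4-0), 2026-08-20.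
-/

namespace Summit.QuantumFields.BalabanUV.Beta.D1BFx.LandauMultiplierMean

open Literature.MathematicalPhysics.QuantumFieldTheory.Balaban1983to89
open Literature.MathematicalPhysics.QuantumFieldTheory.Balaban1983to89.Beta
open ExpKernelCalculus (Site MKer Decays comp)
open B6QGQLower276 (X B blk)
open B5Hk103ScalarZd (gq)
open KernelWard (Bdd bdd_of_decays)
open Summit.QuantumFields.BalabanUV.Beta.TameKernelCalculus (Spr Tame Spr.tame)
open GhostLeg (Ggh Ggh_apply spr_Ggh)
open RProjector (Pgt Pgt_apply Pgt_symm)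
open RProjectorRange (tsum_gq_mul_Pgt)
open RProjectorJet (RG)
open RProjectorJetLeibniz (spr_RG)
open RJetProjector (decays_Pgt)

noncomputable section

variable (n : ℕ) [NeZero n] (a : ℝ)

/-! ## §1 `Q′G′R = 0` -/

/-- [folklore] `Σ_{p ∈ B(y)} G′(q, p) = (G′Q′*)(q, y)` (the definition of `gq`). -/
theorem sum_blk_Ggh (q y : Site 4) (u v : Unit) : ∑ p ∈ B (n - 1) y, Ggh n a q p u v = gq (d := 4) (n - 1) a q y := by
  simp only [Ggh_apply]
  rfl

/-- [folklore] The projector decays (existential form). -/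
theorem spr_Pgt (ha : 0 < a) : Spr (Pgt n a) :=
  ⟨_, _, div_pos (RProjector.deltaPP_pos 4 ha) (by have := NeZero.pos n; positivity), decays_Pgt n a ha⟩

/-- [folklore] Row summability of `z ↦ P(q,z)·G′(z,p)` (a decaying row against a bounded column). -/
theorem summable_Pgt_mul_Ggh (ha : 0 < a) (q p : Site 4) (u v : Unit) :
    Summable fun z : Site 4 => Pgt n a q z u () * Ggh n a z p () v := by
  obtain ⟨hrow, -, -⟩ := (spr_Pgt n a ha).tame
  obtain ⟨φ, hφ, hφ0, hφb⟩ := hrow q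
  obtain ⟨C, δ, hδ, hG⟩ := spr_Ggh n a ha
  have hB : ∀ z, |Ggh n a z p () v| ≤ |C| := fun z => by
    refine (hG z p () v).trans ?_
    have h1 : Real.exp (-δ * B12Sec2to5.l1 (z - p)) ≤ 1 := by
      rw [Real.exp_le_one_iff]; nlinarith [B12Sec2to5.l1_nonneg (z - p)]
    calc C * Real.exp (-δ * B12Sec2to5.l1 (z - p)) ≤ |C| * Real.exp (-δ * B12Sec2to5.l1 (z - p)) :=
          mul_le_mul_of_nonneg_right (le_abs_self C) (Real.exp_pos _).le
      _ ≤ |C| * 1 := mul_le_mul_of_nonneg_left h1 (abs_nonneg C)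
      _ = |C| := mul_one _
  refine Summable.of_norm_bounded (hφ.mul_right |C|) fun z => ?_
  rw [Real.norm_eq_abs, abs_mul]
  exact mul_le_mul (hφb z u ()) (hB z) (abs_nonneg _) (hφ0 z)

/-- [folklore] `Σ_{p ∈ B(y)} (P∘G′)(q,p) = (G′Q′*)(q,y)` — `P` fixes the range of `G′Q′*` (`tsum_gq_mul_Pgt`), read through `Pᵀ = P`. -/
theorem sum_blk_comp_Pgt_Ggh (ha : 0 < a) (q y : Site 4) (u v : Unit) :
    ∑ p ∈ B (n - 1) y, comp (Pgt n a) (Ggh n a) q p u v = gq (d := 4) (n - 1) a q y := by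
  have hc : ∀ p, comp (Pgt n a) (Ggh n a) q p u v = ∑' z : Site 4, Pgt n a q z u () * Ggh n a z p () v := by
    intro p
    simp only [comp, Finset.univ_unique, PUnit.default_eq_unit, Finset.sum_singleton]
  simp only [hc]
  rw [← Summable.tsum_finsetSum (fun p _ => summable_Pgt_mul_Ggh n a ha q p u v)]
  have e : ∀ z : Site 4, ∑ p ∈ B (n - 1) y, Pgt n a q z u () * Ggh n a z p () v = gq (d := 4) (n - 1) a z y * Pgt n a z q () u := by
    intro z
    rw [← Finset.mul_sum, sum_blk_Ggh, Pgt_symm n ha q z u (), mul_comm]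
  simp only [e]
  exact tsum_gq_mul_Pgt n ha y q u

/-- [folklore] **`Q′·G′·R = 0`**: for every fine site `q` and every block `y`, `Σ_{p ∈ B(y)} (R∘G′)(q, p) = 0` (`R∘G′ = G′ − P∘G′` =
`RProjectorJet.RG (Ggh n a) (Pgt n a)`). -/
theorem sum_blk_RG_eq_zero (ha : 0 < a) (q y : Site 4) (u v : Unit) :
    ∑ p ∈ B (n - 1) y, RG (Ggh n a) (Pgt n a) q p u v = 0 := by
  have e : ∀ p, RG (Ggh n a) (Pgt n a) q p u v = Ggh n a q p u v - comp (Pgt n a) (Ggh n a) q p u v := fun p => rfl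
  simp only [e, Finset.sum_sub_distrib, sum_blk_Ggh, sum_blk_comp_Pgt_Ggh n a ha, sub_self]

/-! ## §2 Hypothesis (M) for the dictionary's gauge multiplier -/

/-- [folklore] Column summability of `q ↦ (R∘G′)(q,p)·g(q)` for a bounded `g`. -/
theorem summable_RG_mul (ha : 0 < a) {g : Site 4 → ℝ} {M : ℝ} (hg : ∀ q, |g q| ≤ M) (p : Site 4) (u v : Unit) :
    Summable fun q : Site 4 => RG (Ggh n a) (Pgt n a) q p u v * g q := by
  obtain ⟨-, hcol, -⟩ := (spr_RG (spr_Ggh n a ha) (spr_Pgt n a ha)).tame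
  obtain ⟨ψ, hψ, hψ0, hψb⟩ := hcol p
  have hM : 0 ≤ M := (abs_nonneg _).trans (hg 0)
  refine Summable.of_norm_bounded (hψ.mul_right M) fun q => ?_
  rw [Real.norm_eq_abs, abs_mul]
  exact mul_le_mul (hψb q u v) (hg q) (abs_nonneg _) (hψ0 q)

/-- [folklore] **HYPOTHESIS (M) FOR THE R-WEIGHTED GAUGE MULTIPLIER, UNCONDITIONALLY.**  For every bounded fine function `g`, the 0-form
`μ(p) := Σ'_q (R∘G′)(q,p)·g(q)` (`= (G′Rg)(p)`) has every block sum equal to zero: `Σ_{p ∈ B(y)} μ(p) = 0`. -/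
theorem sum_blk_tsum_RG_mul_eq_zero (ha : 0 < a) {g : Site 4 → ℝ} {M : ℝ} (hg : ∀ q, |g q| ≤ M) (y : Site 4) (u v : Unit) :
    ∑ p ∈ B (n - 1) y, ∑' q : Site 4, RG (Ggh n a) (Pgt n a) q p u v * g q = 0 := by
  rw [← Summable.tsum_finsetSum (fun p _ => summable_RG_mul n a ha hg p u v)]
  have e : ∀ q : Site 4, ∑ p ∈ B (n - 1) y, RG (Ggh n a) (Pgt n a) q p u v * g q = 0 := by
    intro q
    rw [← Finset.sum_mul, sum_blk_RG_eq_zero n a ha, zero_mul]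
  simp only [e, tsum_zero]

end

end Summit.QuantumFields.BalabanUV.Beta.D1BFx.LandauMultiplierMean
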